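import Summits.Ventures.LatticeQCDFlow.Exactness.Phi4FlowLatticeSymmetrisation
import HarnessLib

/-!
# Averaging a flow over a lattice symmetry group that contains the flip: every sticking moment drops, the magnetisation decorrelates at least as fast AT EVERY LAG, and `τ_int(M) = ½ + S_M(q̄)` exactly

HONEST FRAMING: exact (Metropolis-corrected) sampling algorithms for lattice gauge theory;
figures of merit are autocorrelation/cost numbers at stated couplings and volumes; no
continuum-physics claim.  (SCALAR calibration rung S0-A: not a gauge result.)

Venture `LatticeQCDFlow` (cell pub-lqcd), topic `Exactness`; FANOUT row 2 (`s0-phi4`, FLOW arm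
`imhOpPhi4 J λ q̃`; averaged arm `imhOpPhi4 J λ q̄`, `q̄ = |G|⁻¹ Σ_a q̃ ∘ t_a` over the signed site
symmetries `t_a = latticeSymm (ρ a) (ε a)` of a finite group, `Phi4FlowLatticeSymmetrisation`).  NEW
WORK of the cell: the finite-group version of gen-22's lag-by-lag magnetisation comparison
(`Phi4FlowSymmetrisedSampler` §2–§3, there for the two-element group `{id, flip}`).  Two ingredients:
(i) a GENERAL sticking-moment comparison — `r_q̄ ≤ |G|⁻¹ Σ_a r_q̃ ∘ t_a` pointwise
(`groupAvg_rejection_le`) and convexity of `t ↦ tᵏ` give `∫ g² w r_q̄ᵏ ≤ ∫ g² w r_q̃ᵏ` for every `k` and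
every `g` with `g²` invariant (any finite family of measure-preserving symmetries of `w`); (ii) when the
group CONTAINS THE GLOBAL FLIP (`ρ a₀ = 1`, `ε a₀ = −1` for some `a₀`), `q̄` is flip-symmetric, so the
tree's exactness for symmetric models applies to the averaged arm: `ρ^{q̄}_M(k) = E_{M̃²}[r_q̄ᵏ]/Var M`
(`phi4Flow_autocorr_magnetisation_eq_sticking`), which is `≤ E_{M̃²}[r_q̃ᵏ]/Var M ≤ ρ^{q̃}_M(k)` by (i) and
the all-lag sticking floor (`phi4Flow_autocorr_ge_sticking_magnetisation`).  Nothing is cited.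

## What is proved

* `pow_le_avg_pow` — `0 ≤ m ≤ |G|⁻¹ Σ r_a`, `r_a ≥ 0` ⇒ `mᵏ ≤ |G|⁻¹ Σ r_aᵏ`;
* **`groupAvg_stickingMoment_le`** (general) — `∫ g² w r_q̄ᵏ ≤ ∫ g² w r_q̃ᵏ` for `g² ∘ t_a = g²`;
* `latticeSymm_one_neg` (`latticeSymm 1 (−1) φ = −φ`), **`phi4LatticeAvg_symm_of_flip_mem`** — the flip
  in the group ⇒ `q̄(−φ) = q̄(φ)`; `phi4LatticeAvg_facts` — `q̄` is a positive normalised model density;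
* **`phi4LatticeAvg_stickingMoment_magnetisation_le`** — `∫ M̃² e^{−S} r_q̄ᵏ ≤ ∫ M̃² e^{−S} r_q̃ᵏ`, every `k`;
* **`phi4LatticeAvg_autocorr_magnetisation_le`** — flip in the group ⇒ `ρ^{q̄}_M(k+1) ≤ ρ^{q̃}_M(k+1)` at
  EVERY lag, for EVERY network (no summability needed);
* **`phi4LatticeAvg_autocorr_magnetisation_eq`** — and `ρ^{q̄}_M(k) = E_{M̃²}[r_q̄ᵏ]/Var M` exactly;
* **`phi4LatticeAvg_tauInt_magnetisation_eq`** — `τ_int^{q̄}(M) = ½ + S_M(q̄)` exactly when `S_M(q̄) < ∞`.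

NOT CLAIMED: any value for any network; groups without the flip (then only the `τ_int` ordering of
`Phi4FlowLatticeSymmetrisation` is available, under summability); other observables lag by lag
(exactness is special to odd observables); per-cost statements.
-/

namespace Summit.Ventures.LatticeQCDFlow.Exactness

open Real MeasureTheory Filter Finset Set Topology
open Summit.Ventures.LatticeQCDFlow.Scoring

/-- `N`-point convexity of `t ↦ tᵏ` on `[0,∞)`: `0 ≤ m ≤ N⁻¹ Σ r_a` with `r_a ≥ 0` ⇒ `mᵏ ≤ N⁻¹ Σ r_aᵏ`. -/
theorem pow_le_avg_pow {ι : Type*} [Fintype ι] [Nonempty ι] {r : ι → ℝ} {m : ℝ} (hr : ∀ a, 0 ≤ r a)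
    (hm0 : 0 ≤ m) (hm : m ≤ (∑ a, r a) / Fintype.card ι) (k : ℕ) :
    m ^ k ≤ (∑ a, r a ^ k) / Fintype.card ι := by
  have hN : (0 : ℝ) < Fintype.card ι := by exact_mod_cast Fintype.card_pos
  have h := (convexOn_pow k).map_sum_le (t := Finset.univ) (w := fun _ => 1 / (Fintype.card ι : ℝ))
    (p := r) (fun i _ => (div_pos one_pos hN).le)
    (by rw [Finset.sum_const, Finset.card_univ, nsmul_eq_mul]; field_simp) (fun i _ => Set.mem_Ici.2 (hr i))
  simp only [smul_eq_mul] at h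
  have e1 : ∑ i, 1 / (Fintype.card ι : ℝ) * r i = (∑ i, r i) / Fintype.card ι := by
    rw [← Finset.mul_sum]; ring
  have e2 : ∑ i, 1 / (Fintype.card ι : ℝ) * r i ^ k = (∑ i, r i ^ k) / Fintype.card ι := by
    rw [← Finset.mul_sum]; ring
  rw [e1, e2] at h
  exact (pow_le_pow_left₀ hm0 hm k).trans h

section General

variable {X : Type*} [MeasurableSpace X] {μ : Measure X} [SFinite μ] {w q : X → ℝ}
  {ι : Type*} [Fintype ι] [Nonempty ι] {t : ι → X ≃ᵐ X}

/-- **EVERY STICKING MOMENT NEVER INCREASES UNDER GROUP AVERAGING**: a finite nonempty family of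
measure-preserving symmetries of `w`, `q̃ > 0` normalised, `g` measurable with `∫ g² w < ∞` and
`g² ∘ t_a = g²` for all `a`; then for every `k`, `∫ g² w r_q̄ᵏ ≤ ∫ g² w r_q̃ᵏ`. -/
theorem groupAvg_stickingMoment_le (ht : ∀ a, MeasurePreserving (t a) μ μ) (hw0 : ∀ x, 0 < w x)
    (hwm : Measurable w) (hw : ∀ a x, w (t a x) = w x) (hq0 : ∀ x, 0 < q x) (hqm : Measurable q)
    (hqi : Integrable q μ) (hq1 : ∫ z, q z ∂μ = 1) {g : X → ℝ} (hgm : Measurable g)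
    (hg2 : Integrable (fun x => g x ^ 2 * w x) μ) (hg : ∀ a x, g (t a x) ^ 2 = g x ^ 2) (k : ℕ) :
    ∫ x, g x ^ 2 * w x
        * (∫ z, (1 - imhAcceptQ w (fun s => (∑ a, q (t a s)) / Fintype.card ι) x z)
            * ((∑ a, q (t a z)) / Fintype.card ι) ∂μ) ^ k ∂μ
      ≤ ∫ x, g x ^ 2 * w x * (∫ z, (1 - imhAcceptQ w q x z) * q z ∂μ) ^ k ∂μ := by
  have hN : (0 : ℝ) < Fintype.card ι := by exact_mod_cast Fintype.card_pos
  obtain ⟨hs0, hsm, hsi, hs1⟩ := groupAvg_facts ht hq0 hqm hqi hq1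
  obtain ⟨hr0, hr1, hrm⟩ := rejection_bounds (μ := μ) hw0 hwm hq0 hqm hqi hq1
  obtain ⟨hs0', hs1', hsm'⟩ := rejection_bounds (μ := μ) hw0 hwm hs0 hsm hsi hs1
  set r : X → ℝ := fun x => ∫ z, (1 - imhAcceptQ w q x z) * q z ∂μ with hr
  set rs : X → ℝ := fun x => ∫ z, (1 - imhAcceptQ w (fun s => (∑ a, q (t a s)) / Fintype.card ι) x z)
    * ((∑ a, q (t a z)) / Fintype.card ι) ∂μ with hrs
  have hgw0 : ∀ x, 0 ≤ g x ^ 2 * w x := fun x => mul_nonneg (sq_nonneg _) (hw0 x).le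
  set A : X → ℝ := fun x => g x ^ 2 * w x * r x ^ k with hA
  have hAi : Integrable A μ := by
    refine Integrable.mono' hg2 (((hgm.pow_const 2).mul hwm).mul (hrm.pow_const k)).aestronglyMeasurable
      (Eventually.of_forall fun x => ?_)
    rw [Real.norm_eq_abs, abs_of_nonneg (mul_nonneg (hgw0 x) (pow_nonneg (hr0 x) k))]
    exact mul_le_of_le_one_right (hgw0 x) (pow_le_one₀ (hr0 x) (hr1 x))
  have hAa : ∀ a, Integrable (fun x => A (t a x)) μ := fun a => integrable_comp_symmetry ht a hAi
  have hAa_eq : ∀ a x, A (t a x) = g x ^ 2 * w x * r (t a x) ^ k := fun a x => by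
    show g (t a x) ^ 2 * w (t a x) * r (t a x) ^ k = g x ^ 2 * w x * r (t a x) ^ k
    rw [hg a x, hw a x]
  have hint_a : ∀ a, ∫ x, A (t a x) ∂μ = ∫ x, A x ∂μ := fun a => integral_comp_symmetry ht a A
  have hpt : ∀ x, g x ^ 2 * w x * rs x ^ k ≤ (∑ a, A (t a x)) / Fintype.card ι := fun x => by
    have hpow := pow_le_avg_pow (r := fun a => r (t a x)) (fun a => hr0 _) (hs0' x)
      (groupAvg_rejection_le ht hw0 hwm hw hq0 hqm hqi hq1 x) k
    have e : (∑ a, A (t a x)) / Fintype.card ι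
        = g x ^ 2 * w x * ((∑ a, r (t a x) ^ k) / Fintype.card ι) := by
      simp only [hAa_eq]
      rw [← Finset.mul_sum]
      ring
    rw [e]
    exact mul_le_mul_of_nonneg_left hpow (hgw0 x)
  have hint : Integrable (fun x => g x ^ 2 * w x * rs x ^ k) μ := by
    refine Integrable.mono' hg2 (((hgm.pow_const 2).mul hwm).mul (hsm'.pow_const k)).aestronglyMeasurable
      (Eventually.of_forall fun x => ?_)
    rw [Real.norm_eq_abs, abs_of_nonneg (mul_nonneg (hgw0 x) (pow_nonneg (hs0' x) k))]
    exact mul_le_of_le_one_right (hgw0 x) (pow_le_one₀ (hs0' x) (hs1' x))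
  calc ∫ x, g x ^ 2 * w x * rs x ^ k ∂μ ≤ ∫ x, (∑ a, A (t a x)) / Fintype.card ι ∂μ :=
        integral_mono hint ((integrable_finsetSum Finset.univ fun a _ => hAa a).div_const _) hpt
    _ = ∫ x, A x ∂μ := by
        rw [integral_div, integral_finsetSum Finset.univ fun a _ => hAa a]
        simp only [hint_a, Finset.sum_const, Finset.card_univ, nsmul_eq_mul]
        field_simp

end General

/-! ## The lattice -/

section Lattice

variable {n : ℕ} {G : Type*} [Group G] [Fintype G]

/-- The pure flip is the signed site symmetry `(1, −1)`: `latticeSymm 1 (−1) φ = −φ`. -/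
theorem latticeSymm_one_neg (φ : Fin (n + 1) → ℝ) : latticeSymm 1 (-1) φ = -φ := by
  funext x
  rw [latticeSymm_apply, Pi.neg_apply, Units.val_neg, Units.val_one, Int.cast_neg, Int.cast_one,
    neg_one_mul]
  rfl

/-- **If the group contains the global flip, the averaged density is flip-symmetric**:
`ρ a₀ = 1`, `ε a₀ = −1` ⇒ `q̄(−φ) = q̄(φ)`. -/
theorem phi4LatticeAvg_symm_of_flip_mem (ρ : G →* Equiv.Perm (Fin (n + 1))) (ε : G →* ℤˣ)
    {a₀ : G} (hρ : ρ a₀ = 1) (hε : ε a₀ = -1) (q : (Fin (n + 1) → ℝ) → ℝ) (φ : Fin (n + 1) → ℝ) :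
    (∑ a, q (latticeSymm (ρ a) (ε a) (-φ))) / Fintype.card G
      = (∑ a, q (latticeSymm (ρ a) (ε a) φ)) / Fintype.card G := by
  have hflip : latticeSymm (ρ a₀) (ε a₀) φ = -φ := by rw [hρ, hε, latticeSymm_one_neg]
  rw [← hflip]
  exact groupAvg_comp_symmetry (q := q) (t := fun a => (latticeSymm (ρ a) (ε a) : _ → _))
    (latticeSymm_family_mul ρ ε) a₀ φ

/-- `q̄` is a positive, measurable, normalised model density on `ℝ^Λ`. -/
theorem phi4LatticeAvg_facts (ρ : G →* Equiv.Perm (Fin (n + 1))) (ε : G →* ℤˣ)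
    {q : (Fin (n + 1) → ℝ) → ℝ} (hq0 : ∀ φ, 0 < q φ) (hqm : Measurable q) (hqi : Integrable q)
    (hq1 : ∫ φ, q φ = 1) :
    (∀ φ, 0 < (∑ a, q (latticeSymm (ρ a) (ε a) φ)) / Fintype.card G) ∧
    Measurable (fun φ => (∑ a, q (latticeSymm (ρ a) (ε a) φ)) / Fintype.card G) ∧
    Integrable (fun φ => (∑ a, q (latticeSymm (ρ a) (ε a) φ)) / Fintype.card G) ∧
    (∫ φ, (∑ a, q (latticeSymm (ρ a) (ε a) φ)) / Fintype.card G = 1) :=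
  groupAvg_facts (μ := volume) (t := fun a => latticeSymm (ρ a) (ε a))
    (latticeSymm_family_measurePreserving ρ ε) hq0 hqm hqi hq1

/-- **EVERY STICKING MOMENT OF THE MAGNETISATION IS NO LARGER FOR THE AVERAGED ARM**:
`∫ M̃² e^{−S} r_q̄ᵏ ≤ ∫ M̃² e^{−S} r_q̃ᵏ` for every `k`, every network, every such group (flip or not). -/
theorem phi4LatticeAvg_stickingMoment_magnetisation_le {lam : ℝ} (hlam : 0 < lam)
    {J : Fin (n + 1) → Fin (n + 1) → ℝ} {ρ : G →* Equiv.Perm (Fin (n + 1))}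
    (hJ : ∀ a x y, J (ρ a x) (ρ a y) = J x y) (ε : G →* ℤˣ) {q : (Fin (n + 1) → ℝ) → ℝ}
    (hq0 : ∀ φ, 0 < q φ) (hqm : Measurable q) (hqi : Integrable q) (hq1 : ∫ φ, q φ = 1) (k : ℕ) :
    ∫ φ, ((∑ x, φ x) - gibbsExpect J lam (fun ψ => ∑ x, ψ x)) ^ 2 * gibbsWeight J lam φ
        * (∫ φ', (1 - imhAcceptQ (gibbsWeight J lam)
            (fun ψ => (∑ a, q (latticeSymm (ρ a) (ε a) ψ)) / Fintype.card G) φ φ')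
              * ((∑ a, q (latticeSymm (ρ a) (ε a) φ')) / Fintype.card G)) ^ k
      ≤ ∫ φ, ((∑ x, φ x) - gibbsExpect J lam (fun ψ => ∑ x, ψ x)) ^ 2 * gibbsWeight J lam φ
        * (∫ φ', (1 - imhAcceptQ (gibbsWeight J lam) q φ φ') * q φ') ^ k := by
  obtain ⟨hgm, hg2⟩ := polyObs_sq_integrable hlam J
    (polyObs_sub_const polyObs_magnetisation (gibbsExpect J lam (fun ψ => ∑ x, ψ x)))
  -- `M̃² ∘ t_a = M̃²`: `M̃ ∘ t_a = ε(a)·M̃` (`⟨M⟩ ∘ t_a`-invariance from `Phi4FlowLatticeSymmetrisation`)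
  have hmean : ∀ a, gibbsExpect J lam (fun ψ : Fin (n + 1) → ℝ => ∑ x, ψ x)
      = ((ε a : ℤ) : ℝ) * gibbsExpect J lam (fun ψ : Fin (n + 1) → ℝ => ∑ x, ψ x) := fun a => by
    have h := gibbsExpect_comp_latticeSymm (hJ a) (ε a) lam (fun ψ : Fin (n + 1) → ℝ => ∑ x, ψ x)
    have e : (fun φ => (fun ψ : Fin (n + 1) → ℝ => ∑ x, ψ x) (latticeSymm (ρ a) (ε a) φ))
        = fun φ => ((ε a : ℤ) : ℝ) * ∑ x, φ x := funext fun φ => magnetisation_latticeSymm (ρ a) (ε a) φ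
    rw [e] at h
    calc gibbsExpect J lam (fun ψ : Fin (n + 1) → ℝ => ∑ x, ψ x)
        = gibbsExpect J lam (fun φ => ((ε a : ℤ) : ℝ) * ∑ x, φ x) := h.symm
      _ = ((ε a : ℤ) : ℝ) * gibbsExpect J lam (fun ψ : Fin (n + 1) → ℝ => ∑ x, ψ x) := by
          unfold gibbsExpect
          rw [← mul_div_assoc, ← integral_const_mul]
          congr 1
          exact integral_congr_ae (Eventually.of_forall fun φ => by beta_reduce; ring)
  have hsq : ∀ a φ, ((∑ x, latticeSymm (ρ a) (ε a) φ x) - gibbsExpect J lam (fun ψ => ∑ x, ψ x)) ^ 2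
      = ((∑ x, φ x) - gibbsExpect J lam (fun ψ => ∑ x, ψ x)) ^ 2 := fun a φ => by
    have hc : ((ε a : ℤ) : ℝ) ^ 2 = 1 := by
      rw [sq, ← Int.cast_mul, Int.units_coe_mul_self, Int.cast_one]
    rw [magnetisation_latticeSymm]
    conv_lhs => rw [hmean a]
    rw [← mul_sub, mul_pow, hc, one_mul]
  exact groupAvg_stickingMoment_le (μ := volume) (t := fun a => latticeSymm (ρ a) (ε a))
    (latticeSymm_family_measurePreserving ρ ε) (fun φ => gibbsWeight_pos J lam φ)
    (continuous_gibbsWeight J lam).measurable (latticeSymm_family_gibbsWeight hJ ε lam) hq0 hqm hqi hq1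
    hgm hg2 hsq k

/-- **`ρ^{q̄}_M(k) = E_{M̃²}[r_q̄ᵏ]/Var M` EXACTLY** when the group contains the flip (the averaged model
is symmetric; `Phi4FlowSymmetricMagnetisationExact`). -/
theorem phi4LatticeAvg_autocorr_magnetisation_eq {lam : ℝ} (hlam : 0 < lam)
    (J : Fin (n + 1) → Fin (n + 1) → ℝ) (ρ : G →* Equiv.Perm (Fin (n + 1))) (ε : G →* ℤˣ)
    {a₀ : G} (hρ : ρ a₀ = 1) (hε : ε a₀ = -1) {q : (Fin (n + 1) → ℝ) → ℝ} (hq0 : ∀ φ, 0 < q φ)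
    (hqm : Measurable q) (hqi : Integrable q) (hq1 : ∫ φ, q φ = 1) (k : ℕ) :
    (∫ φ, ((∑ x, φ x) - gibbsExpect J lam (fun ψ => ∑ x, ψ x))
        * ((imhOpPhi4 J lam (fun ψ => (∑ a, q (latticeSymm (ρ a) (ε a) ψ)) / Fintype.card G))^[k]
            (fun ψ => (∑ x, ψ x) - gibbsExpect J lam (fun ψ => ∑ x, ψ x))) φ * gibbsWeight J lam φ)
        / ∫ φ, ((∑ x, φ x) - gibbsExpect J lam (fun ψ => ∑ x, ψ x)) ^ 2 * gibbsWeight J lam φ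
      = (∫ φ, ((∑ x, φ x) - gibbsExpect J lam (fun ψ => ∑ x, ψ x)) ^ 2 * gibbsWeight J lam φ
          * (∫ φ', (1 - imhAcceptQ (gibbsWeight J lam)
              (fun ψ => (∑ a, q (latticeSymm (ρ a) (ε a) ψ)) / Fintype.card G) φ φ')
                * ((∑ a, q (latticeSymm (ρ a) (ε a) φ')) / Fintype.card G)) ^ k)
        / ∫ φ, ((∑ x, φ x) - gibbsExpect J lam (fun ψ => ∑ x, ψ x)) ^ 2 * gibbsWeight J lam φ := by
  obtain ⟨hs0, hsm, hsi, hs1⟩ := phi4LatticeAvg_facts ρ ε hq0 hqm hqi hq1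
  exact phi4Flow_autocorr_magnetisation_eq_sticking hlam J hs0 hsm hsi hs1
    (fun φ => phi4LatticeAvg_symm_of_flip_mem ρ ε hρ hε q φ) k

/-- **LAG BY LAG, THE FLIP-CONTAINING GROUP AVERAGE DECORRELATES THE MAGNETISATION AT LEAST AS FAST.**
Every `λ > 0`, real `J` with `ρ(a)` `J`-automorphisms, some `a₀` acting as the pure flip, EVERY
positive measurable model density with `∫ q̃ = 1`, every lag `k`: `ρ^{q̄}_M(k+1) ≤ ρ^{q̃}_M(k+1)`. -/
theorem phi4LatticeAvg_autocorr_magnetisation_le {lam : ℝ} (hlam : 0 < lam)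
    {J : Fin (n + 1) → Fin (n + 1) → ℝ} {ρ : G →* Equiv.Perm (Fin (n + 1))}
    (hJ : ∀ a x y, J (ρ a x) (ρ a y) = J x y) (ε : G →* ℤˣ) {a₀ : G} (hρ : ρ a₀ = 1) (hε : ε a₀ = -1)
    {q : (Fin (n + 1) → ℝ) → ℝ} (hq0 : ∀ φ, 0 < q φ) (hqm : Measurable q) (hqi : Integrable q)
    (hq1 : ∫ φ, q φ = 1) (k : ℕ) :
    (∫ φ, ((∑ x, φ x) - gibbsExpect J lam (fun ψ => ∑ x, ψ x))
        * ((imhOpPhi4 J lam (fun ψ => (∑ a, q (latticeSymm (ρ a) (ε a) ψ)) / Fintype.card G))^[k + 1]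
            (fun ψ => (∑ x, ψ x) - gibbsExpect J lam (fun ψ => ∑ x, ψ x))) φ * gibbsWeight J lam φ)
        / ∫ φ, ((∑ x, φ x) - gibbsExpect J lam (fun ψ => ∑ x, ψ x)) ^ 2 * gibbsWeight J lam φ
      ≤ (∫ φ, ((∑ x, φ x) - gibbsExpect J lam (fun ψ => ∑ x, ψ x))
          * ((imhOpPhi4 J lam q)^[k + 1]
              (fun ψ => (∑ x, ψ x) - gibbsExpect J lam (fun ψ => ∑ x, ψ x))) φ * gibbsWeight J lam φ)
        / ∫ φ, ((∑ x, φ x) - gibbsExpect J lam (fun ψ => ∑ x, ψ x)) ^ 2 * gibbsWeight J lam φ := by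
  rw [phi4LatticeAvg_autocorr_magnetisation_eq hlam J ρ ε hρ hε hq0 hqm hqi hq1 (k + 1)]
  refine le_trans ?_ (phi4Flow_autocorr_ge_sticking_magnetisation hlam J hq0 hqm hqi hq1 k)
  exact div_le_div_of_nonneg_right
    (phi4LatticeAvg_stickingMoment_magnetisation_le hlam hJ ε hq0 hqm hqi hq1 (k + 1))
    (integral_nonneg fun φ => mul_nonneg (sq_nonneg _) (gibbsWeight_pos J lam φ).le)

/-- **`τ_int(M) = ½ + S_M(q̄)` EXACTLY FOR THE FLIP-CONTAINING GROUP AVERAGE OF EVERY NETWORK**: if the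
averaged arm's `M̃²`-weighted sticking column `∫ M̃² e^{−S} r_q̄/(1 − r_q̄)` is finite, the magnetisation's
normalised autocorrelation series under `imhOpPhi4 J λ q̄` is summable and its `τ_int` equals one half
plus that column over `Var M · Z` (the tree's exactness for symmetric models, `q̄` being symmetric). -/
theorem phi4LatticeAvg_tauInt_magnetisation_eq {lam : ℝ} (hlam : 0 < lam)
    (J : Fin (n + 1) → Fin (n + 1) → ℝ) (ρ : G →* Equiv.Perm (Fin (n + 1))) (ε : G →* ℤˣ)
    {a₀ : G} (hρ : ρ a₀ = 1) (hε : ε a₀ = -1) {q : (Fin (n + 1) → ℝ) → ℝ} (hq0 : ∀ φ, 0 < q φ)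
    (hqm : Measurable q) (hqi : Integrable q) (hq1 : ∫ φ, q φ = 1)
    (hS : Integrable (fun φ : Fin (n + 1) → ℝ =>
      ((∑ x, φ x) - gibbsExpect J lam (fun ψ => ∑ x, ψ x)) ^ 2 * gibbsWeight J lam φ
        * ((∫ φ', (1 - imhAcceptQ (gibbsWeight J lam)
              (fun ψ => (∑ a, q (latticeSymm (ρ a) (ε a) ψ)) / Fintype.card G) φ φ')
              * ((∑ a, q (latticeSymm (ρ a) (ε a) φ')) / Fintype.card G))
          / (1 - ∫ φ', (1 - imhAcceptQ (gibbsWeight J lam)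
              (fun ψ => (∑ a, q (latticeSymm (ρ a) (ε a) ψ)) / Fintype.card G) φ φ')
              * ((∑ a, q (latticeSymm (ρ a) (ε a) φ')) / Fintype.card G))))) :
    (Summable fun k => (∫ φ, ((∑ x, φ x) - gibbsExpect J lam (fun ψ => ∑ x, ψ x))
        * ((imhOpPhi4 J lam (fun ψ => (∑ a, q (latticeSymm (ρ a) (ε a) ψ)) / Fintype.card G))^[k + 1]
            (fun ψ => (∑ x, ψ x) - gibbsExpect J lam (fun ψ => ∑ x, ψ x))) φ * gibbsWeight J lam φ)
        / ∫ φ, ((∑ x, φ x) - gibbsExpect J lam (fun ψ => ∑ x, ψ x)) ^ 2 * gibbsWeight J lam φ) ∧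
    tauInt (fun k => (∫ φ, ((∑ x, φ x) - gibbsExpect J lam (fun ψ => ∑ x, ψ x))
        * ((imhOpPhi4 J lam (fun ψ => (∑ a, q (latticeSymm (ρ a) (ε a) ψ)) / Fintype.card G))^[k]
            (fun ψ => (∑ x, ψ x) - gibbsExpect J lam (fun ψ => ∑ x, ψ x))) φ * gibbsWeight J lam φ)
        / ∫ φ, ((∑ x, φ x) - gibbsExpect J lam (fun ψ => ∑ x, ψ x)) ^ 2 * gibbsWeight J lam φ)
      = 1 / 2 + (∫ φ, ((∑ x, φ x) - gibbsExpect J lam (fun ψ => ∑ x, ψ x)) ^ 2 * gibbsWeight J lam φ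
          * ((∫ φ', (1 - imhAcceptQ (gibbsWeight J lam)
                (fun ψ => (∑ a, q (latticeSymm (ρ a) (ε a) ψ)) / Fintype.card G) φ φ')
                * ((∑ a, q (latticeSymm (ρ a) (ε a) φ')) / Fintype.card G))
            / (1 - ∫ φ', (1 - imhAcceptQ (gibbsWeight J lam)
                (fun ψ => (∑ a, q (latticeSymm (ρ a) (ε a) ψ)) / Fintype.card G) φ φ')
                * ((∑ a, q (latticeSymm (ρ a) (ε a) φ')) / Fintype.card G))))
        / ∫ φ, ((∑ x, φ x) - gibbsExpect J lam (fun ψ => ∑ x, ψ x)) ^ 2 * gibbsWeight J lam φ := by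
  obtain ⟨hs0, hsm, hsi, hs1⟩ := phi4LatticeAvg_facts ρ ε hq0 hqm hqi hq1
  exact phi4Flow_tauInt_magnetisation_eq hlam J hs0 hsm hsi hs1
    (fun φ => phi4LatticeAvg_symm_of_flip_mem ρ ε hρ hε q φ) hS

end Lattice

end Summit.Ventures.LatticeQCDFlow.Exactness
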